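import Literature.Computability.Complexity.FKPointLocationStateFP
import Literature.Computability.Complexity.FKPointLocationReadoutFP
import Literature.Computability.Complexity.FKProtocolDriver
import Literature.Computability.Complexity.SignQueryPadding
import Literature.Computability.Complexity.FournierKoiranTransferOracle
import HarnessLib

/-!
# Fournier–Koiran point location, XVII: the location procedure as a one-bit protocol (definitions)

Topic `Literature/Computability/Complexity`, grouping namespace `FKPointLocation`. The location
procedure of Fournier–Koiran (ICALP 2000 = LIP RR-1999-21, §2, Thm 2) as a ONE-BIT PROTOCOL in the
sense of `FKProtocolDriver.lean` (selector `isNP`, sign probes `qry`, `NP` statements `Lnp`, answer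
stream `FKTransfer.answers … (signEnv x) n t`), in dimension `n` with the level parameters
`QOf T n = paramsOf n (T(n)+1)` (coefficient bound `2^{T(n)+1}`, homogenised dimension `n + 1`):

* `utask` (the scheduled task after `|prev|` answers), `isNPOf`, the probe `qryOf m` (the integer
  list `squeryList` of the queried form `uqueryForm` of the replayed state `ustate`, coded by
  `encodingIntBool.listBool` and padded to length `m(n)`), the verifier language `LverOf` (the checks
  `ucheck` of `FKPointLocationChecksFP.lean` on the decoded input) and the statements `LnpOf qc`;
* the read-out `readout` (denominator and numerators of the de-homogenised located point);
* list lemmas, the prefix property of the answer stream (`answers_add`), and the typed reference run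
  (`tdat`, `tans`: the states and truthful answers of the typed protocol of
  `FKPointLocationProtocol.lean` on `x̂ = (x, 1)`), against which the protocol is compared in
  `FKPointLocationProtocolRun.lean`.

## References

* H. Fournier, P. Koiran, *Lower bounds are not easier over the reals: inside PH*, ICALP 2000,
  LNCS 1853 = LIP RR-1999-21, §2.1, §2.3, Thm 2, Thm 3 (p. 11). [FournierKoiran2000]
-/

namespace Literature.Computability.Complexity

namespace FKPointLocation

open _root_.Computability CodeFP Polynomial FKTransfer Brick

/-! ### The protocol in dimension `n` -/

section Defs

variable (T : Polynomial ℕ)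

/-- The level parameters in dimension `n`: `D = n + 1`, `B = 2^{T(n)+1}`. [cite: FournierKoiran2000, §2.1–2.3] -/
def QOf (n : ℕ) : LevelParams := paramsOf n (T.eval n + 1)

/-- Their untyped record. [folklore] -/
abbrev POf (n : ℕ) : UParams := (QOf T n).toU

/-- The scheduled task after the answers `prev` (the final task past the schedule). [cite: FournierKoiran2000, §2.1] -/
def utask (P : UParams) (prev : List Bool) : UTask := (uagenda P).getD prev.length UTask.fin

/-- **The selector**: the next question is an `NP` question iff the scheduled task is not a sign task.
[cite: FournierKoiran2000, §2.1] -/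
def isNPOf (n : ℕ) (prev : List Bool) : Bool := !(utask (POf T n) prev).isSign

/-- The integer list `[a_n + c, a_0, …, a_{n-1}]` of the sign query, on `x ∈ ℝⁿ`, of the homogeneous
form `(a, c)` at `x̂ = (x, 1)`. [cite: FournierKoiran2000, §2.3 (`x_{n+1} = 1`)] -/
def squeryList (n : ℕ) (φ : UAff) : List ℤ := (vget φ.1 n + φ.2) :: φ.1.take n

/-- The integer list probed after the answers `prev`. [cite: FournierKoiran2000, §2.1 Step k] -/
def probeOf (n : ℕ) (prev : List Bool) : List ℤ :=
  squeryList n (uqueryForm (POf T n) (ustate (POf T n) prev) (utask (POf T n) prev))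

/-- **The probe**: the code of the probed list, padded (or cut) to length `m(n)`. [cite: FournierKoiran2000, §2.1–2.2] -/
def qryOf (m : Polynomial ℕ) (n : ℕ) (prev : List Bool) : List Bool :=
  (listE smE (probeOf T n prev)).takeD (m.eval n) false

/-- **The verifier language** of the `NP` statements: `⟨⟨1ⁿ, prev⟩, cert⟩` such that `cert` passes the
check of the scheduled task in the replayed state. [cite: FournierKoiran2000, §2.1] -/
def LverOf : Language Bool :=
  {z | ucheck (POf T (fstF (fstF z)).length) (2 ^ (T.eval (fstF (fstF z)).length + 1))
    (ustate (POf T (fstF (fstF z)).length) (sndF (fstF z))) (utask (POf T (fstF (fstF z)).length) (sndF (fstF z))) (sndF z) = true}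

/-- **The `NP` statements**: some certificate of length `≤ qc(|w|)` passes. [cite: FournierKoiran2000, §2.1] -/
def LnpOf (qc : Polynomial ℕ) : Language Bool :=
  {w | ∃ y : List Bool, y.length ≤ qc.eval w.length ∧ boolPair w y ∈ LverOf T}

/-- **The read-out**: denominator and numerators of the de-homogenised located point, from the
homogeneous integer coordinates `uxsOf` of the replayed state. [cite: FournierKoiran2000, §2.3–2.4, p. 11] -/
def readout (n : ℕ) (prev : List Bool) : ℕ × List ℤ :=
  ((vget (uxsOf (POf T n) (POf T n).amax (ustate (POf T n) prev).levels).1 n).toNat,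
    (uxsOf (POf T n) (POf T n).amax (ustate (POf T n) prev).levels).1.take n)

end Defs

/-! ### List lemmas -/

section Lists

variable {α β : Type}

/-- `takeD` beyond the length pads. [folklore] -/
theorem takeD_eq_append_of_le (l : List α) (d : α) {k : ℕ} (h : l.length ≤ k) :
    l.takeD k d = l ++ List.replicate (k - l.length) d := by
  induction l generalizing k with
  | nil => simp
  | cons a l ih =>
    cases k with
    | zero => simp at h
    | succ k =>
      rw [List.takeD_succ, List.cons_append]
      simp only [List.head?_cons, Option.getD_some, List.tail_cons, List.length_cons, Nat.add_sub_add_right]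
      rw [ih (by simpa using h)]

/-- Zipping with a list extended by one item beyond a full prefix. [folklore] -/
theorem zip_append_singleton_of_lt (l : List α) (p : List β) (b : β) (h : p.length < l.length) :
    l.zip (p ++ [b]) = l.zip p ++ [(l[p.length], b)] := by
  induction l generalizing p with
  | nil => simp at h
  | cons a l ih =>
    cases p with
    | nil => simp
    | cons c p =>
      rw [List.cons_append, List.zip_cons_cons, List.zip_cons_cons, ih p (by simpa using h), List.cons_append]
      rfl

/-- Zipping ignores the items of the second list beyond the first. [folklore] -/
theorem zip_append_of_length_le (l : List α) (p q : List β) (h : l.length ≤ p.length) : l.zip (p ++ q) = l.zip p := by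
  induction l generalizing p with
  | nil => simp
  | cons a l ih =>
    cases p with
    | nil => simp at h
    | cons c p => rw [List.cons_append, List.zip_cons_cons, List.zip_cons_cons, ih p (by simpa using h)]

/-- `getD` of a mapped list inside the range. [folklore] -/
theorem getD_map_of_lt (f : α → β) (l : List α) (d : β) (d' : α) {i : ℕ} (h : i < l.length) :
    (l.map f).getD i d = f (l.getD i d') := by
  rw [List.getD_eq_getElem _ _ (by simpa using h), List.getD_eq_getElem _ _ h, List.getElem_map]

end Lists

/-! ### The answers are prefixes of one another -/

section Answers

variable {isNP : ℕ → List Bool → Bool} {qry : ℕ → List Bool → List Bool} {Lnp : Language Bool}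

/-- Later answer lists extend earlier ones. [folklore] -/
theorem answers_add (σ : List Bool → Bool) (n t : ℕ) : ∀ k, ∃ e : List Bool,
    answers isNP qry Lnp σ n (t + k) = answers isNP qry Lnp σ n t ++ e
  | 0 => ⟨[], by simp⟩
  | k + 1 => by
    obtain ⟨e, he⟩ := answers_add σ n t k
    exact ⟨e ++ [nextAns isNP qry Lnp σ n (answers isNP qry Lnp σ n (t + k))], by
      rw [← Nat.add_assoc, answers_succ, he, List.append_assoc]⟩

end Answers

/-! ### The typed reference run -/

section Run

variable (T : Polynomial ℕ) (n : ℕ) (x : Fin n → ℝ)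

/-- The final question of the typed protocol is not used by the location part (it is asked by the
driver, `FKProtocolDriver`); any statement will do. [folklore] -/
def finT : Cert (QOf T n).D → Prop := fun _ => False

/-- The typed state after `t` scheduled tasks, with truthful answers on `x̂ = (x, 1)`. [cite: FournierKoiran2000, §2.1] -/
noncomputable def tdat (t : ℕ) : Data (QOf T n).D :=
  runFrom (QOf T n) (finT T n) (hat x) (Data.init (QOf T n).D) ((agenda (QOf T n)).take t)

/-- The typed truthful answers to the first `t` scheduled tasks. [cite: FournierKoiran2000, §2.1] -/
noncomputable def tans : ℕ → List Bool
  | 0 => []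
  | t + 1 => tans t ++ [truth (finT T n) (certOf (QOf T n)) (hat x) (tdat T n x t) ((agenda (QOf T n)).getD t Task.close)]

variable {T n x}

/-- `|tans t| = t`. [folklore] -/
@[simp] theorem length_tans : ∀ t, (tans T n x t).length = t
  | 0 => rfl
  | t + 1 => by rw [tans, List.length_append, length_tans t]; rfl

/-- The typed state advances by one truthful step. [folklore] -/
theorem tdat_succ {t : ℕ} (ht : t < (agenda (QOf T n)).length) :
    tdat T n x (t + 1) = step (QOf T n) (finT T n) (hat x) (tdat T n x t) ((agenda (QOf T n)).getD t Task.close) := by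
  rw [tdat, tdat, List.take_add_one, List.getElem?_eq_getElem ht, Option.toList_some, runFrom_append, runFrom_cons, runFrom_nil,
    List.getD_eq_getElem _ _ ht]

/-- After the whole schedule the typed state is `finalData`. [folklore] -/
theorem tdat_length : tdat T n x (agenda (QOf T n)).length = finalData (QOf T n) (finT T n) (hat x) := by
  rw [tdat, List.take_length]; rfl

/-- `x̂ ≠ 0`. [cite: FournierKoiran2000, §2.3] -/
theorem hat_ne_zero : ∃ i, hat x i ≠ 0 := ⟨Fin.last n, by simp [hat]⟩

end Run

end FKPointLocation

end Literature.Computability.Complexity
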